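import Mathlib
import Summits.Ventures.PercRepro2.TB14Slide

/-!
# A degree-two mark between two non-root vertices: the exact three-term identity (typed BHK 1.4)
(blind cell PercRepro2, mine-c g18, 2026-08-25; `proofs/MINEC-TB14BLOCK.md` §12)

Let the mark `b` have exactly two edges `e₁ = b u` and `e₂ = b v`, both free (`u, v` arbitrary
vertices other than `b`).  In the folded kernel
`foldK = 1_Q(y) 1_Q(w) 1[b ∈ C_y(a₁)] (1[o ∈ C_w(a₂)] − 1[o ∈ C_y(a₂)])` the mark lives in the first
copy `y`; split the two-copy sum on the four colourings of `(e₁, e₂)` in `y`: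
* both closed: `b` is isolated in `y`, the kernel vanishes;
* `e₁` open, `e₂` closed: `b` is a leaf at `u` in `y` and a leaf at `v` in `w`; every connection
  off `b` is that of the configuration with both edges closed and `a₁ ↔ b` in `y` is `a₁ ↔ u` —
  the kernel of the mark `u` (and symmetrically the mark `v` for `e₂` open, `e₁` closed);
* both open: the path `u – b – v` of `y` is the single edge `u v` of the rerouted graph
  `ends[e₁ ↦ s(u, v)]` with `e₁` open in the first copy only, and `b` is isolated in `w`.
Hence (`pairCount_foldK_deg2mark`)

  `D(G; a₁, a₂, b, o) = D(G − b; a₁, a₂, u, o) + D(G − b; a₁, a₂, v, o) + T(G − b; {u, v}, o)`,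

where `T` is the two-copy count, at the profile with `e₁, e₂` closed, of the kernel
`(y₂, w₂) ↦ foldK (ends[e₁ ↦ s(u, v)]) a₁ a₂ u o (y₂[e₁ ↦ 1]) w₂` — the «blue-only star» at the
virtual mark: `1_Q 1_Q [C_y(a₁) ∩ {u, v} ≠ ∅][C_y(a₂) ∩ {u, v} = ∅](1[o ∈ C_w(a₂)] − 1[o ∈ C_y(a₂)])`.
Exact check `data/mine-c/g18/scripts/deg2id.c` (n = 7 all graphs 62,640 instances, n = 8
two-connected m ≤ 14 522,500 instances, 0 failures).  Own work; standard axioms.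
-/

namespace Summit.Ventures.PercRepro2

namespace TB14Cut

open CovForm A3InactiveTyped

section Deg2Mark

variable {V : Type} {E : Type} [Fintype E] [DecidableEq E] {R : Type*} [Field R]
variable {ends : E → Sym2 V} {e₁ e₂ : E} {b u v a₁ a₂ o : V}

omit [Fintype E] [DecidableEq E] in
/-- The folded kernel with the mark `b` replaced by `x` and the graph replaced by `ends'`: when all
connections off `b` agree in the two copies and `a₁ ↔ b` in `y` is `a₁ ↔ x` in `y'`. -/
lemma foldK_congr_mark' {ends' : E → Sym2 V} {x : V} {y y' w w' : Config E} (ha₁ : a₁ ≠ b)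
    (ha₂ : a₂ ≠ b) (ho : o ≠ b)
    (h1 : ∀ t t' : V, t ≠ b → t' ≠ b → (Conn ends y t t' ↔ Conn ends' y' t t'))
    (h2 : ∀ t t' : V, t ≠ b → t' ≠ b → (Conn ends w t t' ↔ Conn ends' w' t t'))
    (hbx : Conn ends y a₁ b ↔ Conn ends' y' a₁ x) :
    (foldK ends a₁ a₂ b o y w : R) = foldK ends' a₁ a₂ x o y' w' := by
  classical
  simp only [foldK, iQ_eq_ite', iL_eq_ite', iH_eq_ite', h1 a₁ a₂ ha₁ ha₂, hbx, h1 a₂ o ha₂ ho,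
    h2 a₁ a₂ ha₁ ha₂, h2 a₂ o ha₂ ho]

omit [Fintype E] in
/-- The second copy of the configuration with both edges at `b` open in the first copy is the
second copy of the profile with both edges closed. -/
lemma flipOn_both_open (he : e₁ ≠ e₂) (F : Finset E) (h₁F : e₁ ∈ F) (h₂F : e₂ ∈ F)
    (y₂ : Config E) (hy₂₁ : y₂ e₁ = false) (hy₂₂ : y₂ e₂ = false) :
    A3InactiveTyped.flipOn F (Function.update (Function.update y₂ e₁ true) e₂ true) =
      A3InactiveTyped.flipOn ((F.erase e₂).erase e₁) y₂ := by
  funext f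
  by_cases hf₂ : f = e₂
  · subst hf₂
    rw [A3InactiveTyped.flipOn_of_mem h₂F, Function.update_self,
      A3InactiveTyped.flipOn_of_notMem (fun h => Finset.notMem_erase f F (Finset.mem_of_mem_erase h))]
    exact hy₂₂.symm
  by_cases hf₁ : f = e₁
  · subst hf₁
    rw [A3InactiveTyped.flipOn_of_mem h₁F, Function.update_of_ne hf₂, Function.update_self,
      A3InactiveTyped.flipOn_of_notMem (Finset.notMem_erase f (F.erase e₂))]
    exact hy₂₁.symm
  · by_cases hfF : f ∈ F
    · rw [A3InactiveTyped.flipOn_of_mem hfF,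
        A3InactiveTyped.flipOn_of_mem (Finset.mem_erase.2 ⟨hf₁, Finset.mem_erase.2 ⟨hf₂, hfF⟩⟩),
        Function.update_of_ne hf₂, Function.update_of_ne hf₁]
    · rw [A3InactiveTyped.flipOn_of_notMem hfF,
        A3InactiveTyped.flipOn_of_notMem (fun h => hfF (Finset.mem_of_mem_erase (Finset.mem_of_mem_erase h))),
        Function.update_of_ne hf₂, Function.update_of_ne hf₁]

/-- **The degree-two mark identity** (THEOREM, `MINEC-TB14BLOCK.md` §12): if the mark `b` has
exactly the two free edges `e₁ = b u` and `e₂ = b v`, then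
`D(G; b) = D(G − b; u) + D(G − b; v) + T(G − b; {u, v})`, where the last term is the two-copy
count, at the profile with both edges closed, of the folded kernel of the mark `u` on the rerouted
graph `ends[e₁ ↦ s(u, v)]` with `e₁` opened in the first copy only. -/
theorem pairCount_foldK_deg2mark (he : e₁ ≠ e₂) (h₁ : ends e₁ = s(b, u)) (h₂ : ends e₂ = s(b, v))
    (hbu : b ≠ u) (hbv : b ≠ v) (hb : ∀ f, b ∈ ends f → f = e₁ ∨ f = e₂)
    (ha₁ : a₁ ≠ b) (ha₂ : a₂ ≠ b) (ho : o ≠ b) (F : Finset E) (z : Config E) (h₁F : e₁ ∈ F)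
    (h₂F : e₂ ∈ F) :
    pairCount F z (foldK ends a₁ a₂ b o : Config E → Config E → R) =
      pairCount ((F.erase e₂).erase e₁) (Function.update (Function.update z e₂ false) e₁ false)
          (foldK ends a₁ a₂ u o) +
        pairCount ((F.erase e₂).erase e₁) (Function.update (Function.update z e₂ false) e₁ false)
          (foldK ends a₁ a₂ v o) +
        pairCount ((F.erase e₂).erase e₁) (Function.update (Function.update z e₂ false) e₁ false)
          (fun y₂ w₂ => foldK (Function.update ends e₁ s(u, v)) a₁ a₂ u o
            (Function.update y₂ e₁ true) w₂) := by
  classical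
  set ends' := Function.update ends e₁ s(u, v) with hends'
  set F' := F.erase e₂ with hF'
  set z' := Function.update z e₂ false with hz'
  set F'' := F'.erase e₁ with hF''
  set z'' := Function.update z' e₁ false with hz''
  have h₁F' : e₁ ∈ F' := Finset.mem_erase.2 ⟨he, h₁F⟩
  have hb₁ : ∀ f, b ∈ ends f → f ≠ e₁ → f = e₂ := fun f hf hf₁ => (hb f hf).resolve_left hf₁
  have hb₂ : ∀ f, b ∈ ends f → f ≠ e₂ → f = e₁ := fun f hf hf₂ => (hb f hf).resolve_right hf₂
  have hends'_ne : ∀ f, f ≠ e₁ → ends' f = ends f := fun f hf => by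
    rw [hends', Function.update_of_ne hf]
  -- (C) `e₁` open, `e₂` closed in the first copy: the mark slides to `u`
  have hC : ∀ y₂ : Config E, y₂ e₁ = false → y₂ e₂ = false →
      (foldK ends a₁ a₂ b o (Function.update y₂ e₁ true)
          (A3InactiveTyped.flipOn F (Function.update y₂ e₁ true)) : R) =
        foldK ends a₁ a₂ u o y₂ (A3InactiveTyped.flipOn F'' y₂) := by
    intro y₂ hy₂₁ hy₂₂
    set y := Function.update y₂ e₁ true with hy
    set w := A3InactiveTyped.flipOn F y with hw
    have hy₁ : y e₁ = true := Function.update_self _ _ _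
    have hy₂ : y e₂ = false := by rw [hy, Function.update_of_ne he.symm]; exact hy₂₂
    have hyback : Function.update y e₁ false = y₂ := by
      rw [hy, Function.update_idem, ← hy₂₁]; exact Function.update_eq_self e₁ y₂
    have hleafy : ∀ f, b ∈ ends f → f ≠ e₁ → y f = false := by
      intro f hf hf₁
      rw [hb₁ f hf hf₁]; exact hy₂
    have hw₁ : w e₁ = false := by
      rw [hw, A3InactiveTyped.flipOn_of_mem h₁F, hy₁]; rfl
    have hw₂ : w e₂ = true := by
      rw [hw, A3InactiveTyped.flipOn_of_mem h₂F, hy₂]; rfl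
    have hleafw : ∀ f, b ∈ ends f → f ≠ e₂ → w f = false := by
      intro f hf hf₂
      rw [hb₂ f hf hf₂]; exact hw₁
    have hwback : Function.update w e₂ false = A3InactiveTyped.flipOn F'' y₂ := by
      funext f
      by_cases hf₂ : f = e₂
      · subst hf₂
        rw [Function.update_self,
          A3InactiveTyped.flipOn_of_notMem (fun h => Finset.notMem_erase f F (Finset.mem_of_mem_erase h))]
        exact hy₂₂.symm
      by_cases hf₁ : f = e₁
      · subst hf₁
        rw [Function.update_of_ne hf₂, hw₁, A3InactiveTyped.flipOn_of_notMem (Finset.notMem_erase f F')]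
        exact hy₂₁.symm
      · rw [Function.update_of_ne hf₂, hw]
        by_cases hfF : f ∈ F
        · rw [A3InactiveTyped.flipOn_of_mem hfF,
            A3InactiveTyped.flipOn_of_mem (Finset.mem_erase.2 ⟨hf₁, Finset.mem_erase.2 ⟨hf₂, hfF⟩⟩),
            hy, Function.update_of_ne hf₁]
        · rw [A3InactiveTyped.flipOn_of_notMem hfF,
            A3InactiveTyped.flipOn_of_notMem (fun h => hfF
              (Finset.mem_of_mem_erase (Finset.mem_of_mem_erase h))), hy,
            Function.update_of_ne hf₁]
    refine foldK_congr_mark ha₁ ha₂ ho ?_ ?_ ?_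
    · intro t t' ht ht'
      rw [conn_leaf_erase h₁ hbu hleafy hy₁ ht ht', hyback]
    · intro t t' ht ht'
      rw [conn_leaf_erase h₂ hbv hleafw hw₂ ht ht', hwback]
    · rw [conn_mark_leaf h₁ hbu hleafy hy₁ ha₁, hyback]
  -- (B) `e₂` open, `e₁` closed in the first copy: the mark slides to `v`
  have hB : ∀ y₂ : Config E, y₂ e₁ = false → y₂ e₂ = false →
      (foldK ends a₁ a₂ b o (Function.update y₂ e₂ true)
          (A3InactiveTyped.flipOn F (Function.update y₂ e₂ true)) : R) =
        foldK ends a₁ a₂ v o y₂ (A3InactiveTyped.flipOn F'' y₂) := by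
    intro y₂ hy₂₁ hy₂₂
    set y := Function.update y₂ e₂ true with hy
    set w := A3InactiveTyped.flipOn F y with hw
    have hy₂ : y e₂ = true := Function.update_self _ _ _
    have hy₁ : y e₁ = false := by rw [hy, Function.update_of_ne he]; exact hy₂₁
    have hyback : Function.update y e₂ false = y₂ := by
      rw [hy, Function.update_idem, ← hy₂₂]; exact Function.update_eq_self e₂ y₂
    have hleafy : ∀ f, b ∈ ends f → f ≠ e₂ → y f = false := by
      intro f hf hf₂
      rw [hb₂ f hf hf₂]; exact hy₁
    have hw₂ : w e₂ = false := by
      rw [hw, A3InactiveTyped.flipOn_of_mem h₂F, hy₂]; rfl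
    have hw₁ : w e₁ = true := by
      rw [hw, A3InactiveTyped.flipOn_of_mem h₁F, hy₁]; rfl
    have hleafw : ∀ f, b ∈ ends f → f ≠ e₁ → w f = false := by
      intro f hf hf₁
      rw [hb₁ f hf hf₁]; exact hw₂
    have hwback : Function.update w e₁ false = A3InactiveTyped.flipOn F'' y₂ := by
      funext f
      by_cases hf₁ : f = e₁
      · subst hf₁
        rw [Function.update_self, A3InactiveTyped.flipOn_of_notMem (Finset.notMem_erase f F')]
        exact hy₂₁.symm
      by_cases hf₂ : f = e₂
      · subst hf₂
        rw [Function.update_of_ne hf₁, hw₂,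
          A3InactiveTyped.flipOn_of_notMem (fun h => Finset.notMem_erase f F (Finset.mem_of_mem_erase h))]
        exact hy₂₂.symm
      · rw [Function.update_of_ne hf₁, hw]
        by_cases hfF : f ∈ F
        · rw [A3InactiveTyped.flipOn_of_mem hfF,
            A3InactiveTyped.flipOn_of_mem (Finset.mem_erase.2 ⟨hf₁, Finset.mem_erase.2 ⟨hf₂, hfF⟩⟩),
            hy, Function.update_of_ne hf₂]
        · rw [A3InactiveTyped.flipOn_of_notMem hfF,
            A3InactiveTyped.flipOn_of_notMem (fun h => hfF
              (Finset.mem_of_mem_erase (Finset.mem_of_mem_erase h))), hy,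
            Function.update_of_ne hf₂]
    refine foldK_congr_mark ha₁ ha₂ ho ?_ ?_ ?_
    · intro t t' ht ht'
      rw [conn_leaf_erase h₂ hbv hleafy hy₂ ht ht', hyback]
    · intro t t' ht ht'
      rw [conn_leaf_erase h₁ hbu hleafw hw₁ ht ht', hwback]
    · rw [conn_mark_leaf h₂ hbv hleafy hy₂ ha₁, hyback]
  -- (D) both open in the first copy: the path `u – b – v` is the rerouted edge
  have hD : ∀ y₂ : Config E, y₂ e₁ = false → y₂ e₂ = false →
      (foldK ends a₁ a₂ b o (Function.update (Function.update y₂ e₁ true) e₂ true)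
          (A3InactiveTyped.flipOn F (Function.update (Function.update y₂ e₁ true) e₂ true)) : R) =
        foldK ends' a₁ a₂ u o (Function.update y₂ e₁ true) (A3InactiveTyped.flipOn F'' y₂) := by
    intro y₂ hy₂₁ hy₂₂
    set y := Function.update (Function.update y₂ e₁ true) e₂ true with hy
    have hy₁ : y e₁ = true := by
      rw [hy, Function.update_of_ne he, Function.update_self]
    have hy₂ : y e₂ = true := Function.update_self _ _ _
    have hyback : Function.update y e₂ false = Function.update y₂ e₁ true := by
      rw [hy, Function.update_idem]
      have : Function.update y₂ e₁ true e₂ = false := by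
        rw [Function.update_of_ne he.symm]; exact hy₂₂
      rw [← this]; exact Function.update_eq_self e₂ _
    have hw : A3InactiveTyped.flipOn F y = A3InactiveTyped.flipOn F'' y₂ := flipOn_both_open he F h₁F h₂F y₂ hy₂₁ hy₂₂
    have hw₁ : A3InactiveTyped.flipOn F'' y₂ e₁ = false := by
      rw [A3InactiveTyped.flipOn_of_notMem (Finset.notMem_erase e₁ F')]; exact hy₂₁
    have hw₂ : A3InactiveTyped.flipOn F'' y₂ e₂ = false := by
      rw [A3InactiveTyped.flipOn_of_notMem (fun h => Finset.notMem_erase e₂ F (Finset.mem_of_mem_erase h))]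
      exact hy₂₂
    rw [hw]
    refine foldK_congr_mark' ha₁ ha₂ ho ?_ ?_ ?_
    · intro t t' ht ht'
      rw [conn_series he h₁ h₂ hbu hbv hb hy₁ hy₂ ht ht', hyback]
    · intro t t' _ _
      exact conn_closed_pair (e₂ := e₂) hends'_ne hw₁ hw₂ hw₁ hw₂ (fun _ _ _ => rfl) t t'
    · have hadj : Conn ends y b u := conn_of_openAdj ⟨e₁, hy₁, h₁⟩
      have h1u : Conn ends y a₁ b ↔ Conn ends y a₁ u :=
        ⟨fun h => conn_trans h hadj, fun h => conn_trans h (conn_symm hadj)⟩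
      rw [h1u, conn_series he h₁ h₂ hbu hbv hb hy₁ hy₂ ha₁ hbu.symm, hyback]
  -- the counting: split on `e₂`, then on `e₁`
  unfold pairCount
  rw [sum_admissible_split h₂F, ← hF', ← hz', sum_admissible_split h₁F', ← hF'', ← hz'',
    ← Finset.sum_add_distrib, ← Finset.sum_add_distrib]
  refine Finset.sum_congr rfl fun y₂ _ => ?_
  by_cases hadm : ∀ f, f ∉ F'' → y₂ f = z'' f
  · rw [if_pos hadm, if_pos hadm, if_pos hadm, if_pos hadm]
    have hy₂₁ : y₂ e₁ = false := by
      have := hadm e₁ (Finset.notMem_erase e₁ F')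
      rwa [hz'', Function.update_self] at this
    have hy₂₂ : y₂ e₂ = false := by
      have := hadm e₂ (fun h => Finset.notMem_erase e₂ F (Finset.mem_of_mem_erase h))
      rwa [hz'', Function.update_of_ne he.symm, hz', Function.update_self] at this
    have hself₁ : Function.update y₂ e₁ false = y₂ := by
      rw [← hy₂₁]; exact Function.update_eq_self e₁ y₂
    have hself₂ : Function.update y₂ e₂ false = y₂ := by
      rw [← hy₂₂]; exact Function.update_eq_self e₂ y₂
    have hself₂' : Function.update (Function.update y₂ e₁ true) e₂ false =
        Function.update y₂ e₁ true := by
      have : Function.update y₂ e₁ true e₂ = false := by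
        rw [Function.update_of_ne he.symm]; exact hy₂₂
      rw [← this]; exact Function.update_eq_self e₂ _
    rw [hself₁, hself₂, hself₂']
    -- (A) both closed: `b` is isolated in the first copy
    have hA : (foldK ends a₁ a₂ b o y₂ (A3InactiveTyped.flipOn F y₂) : R) = 0 := by
      refine foldK_eq_zero_of_not_conn (not_conn_isolated ?_ ha₁)
      intro f hf
      rcases hb f hf with rfl | rfl
      · exact hy₂₁
      · exact hy₂₂
    rw [hA, hB y₂ hy₂₁ hy₂₂, hC y₂ hy₂₁ hy₂₂, hD y₂ hy₂₁ hy₂₂]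
    ring
  · rw [if_neg hadm, if_neg hadm, if_neg hadm, if_neg hadm]
    ring

end Deg2Mark

end TB14Cut

end Summit.Ventures.PercRepro2
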